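import Mathlib.Analysis.SpecialFunctions.Pow.Asymptotics
import Mathlib.Analysis.Convex.SpecificFunctions.Basic
import Literature.Computability.AlgebraicComplexity.ValiantClasses

/-!
# `DetqpThesis` (stmt-ValiantsHypothesis-0315), line `fat-row-recursion` — stub S4 `stub_telescope`

Pure real analysis, no algebra.  A sequence `r ≥ 1` (from `n₀` on) satisfying the fat-increment
recursion `r(n+1) ≤ (n+1)^{1-ε} · (r(n+1) − r(n))` for all `n ≥ n₀` grows at least like
`exp(((n+1)^ε − (n₀+1)^ε)/ε)` when `0 < ε ≤ 1` (for `ε > 1` the recursion is only stronger, so we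
replace `ε` by `min ε 1`), and `exp(((N+1)^ε − C₀)/ε)` beats `N^k · 2^{(log₂ N + c)^c}` for large
`N` (`log N` and `log^c N` are `o(N^ε)`), so no `d` with `r ≤ n^k · d` from `n₀` on is
quasi-polynomially bounded (`IsQPBounded d = ∃ c, ∀ n, d n ≤ 2^{(Nat.log 2 n + c)^c}`).

## Proof
* one step (`mul_exp_rpow_le_of_step`): with `m = n + 1`, `x = m^{ε-1}`, the recursion reads
  `r(n) ≤ (1 − x)·r(m) ≤ e^{−x}·r(m)`, i.e. `r(n)·eˣ ≤ r(m)`;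
* Bernoulli for real exponents `0 ≤ ε ≤ 1` (Mathlib `rpow_one_add_le_one_add_mul_self`):
  `(m+1)^ε ≤ m^ε + ε·m^{ε-1}` (`rpow_add_one_sub_rpow_le`), so the exponents telescope without
  integrals: `exp(((N+1)^ε − (n₀+1)^ε)/ε) ≤ r(N)` for `N ≥ n₀` (`exp_telescope_le`);
* conclusion (`not_isQPBounded_of_recursion_of_le_one`): `(Nat.log 2 N)·log 2 ≤ log N`,
  `(L + c)^c ≤ 2^c·L^c` once `c ≤ L = Nat.log 2 N` (i.e. `2^c ≤ N`), and `log N`, `(log N)^c` are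
  `o(N^ε)` (Mathlib `isLittleO_log_rpow_atTop`, `isLittleO_log_rpow_rpow_atTop`); an `N ≥ n₀`
  from `Filter.eventually_atTop` then contradicts the chain
  `exp(((N+1)^ε − C₀)/ε) ≤ r N ≤ N^k·d N ≤ N^k·2^{(L+c)^c}`.

Only Mathlib and `IsQPBounded` (Literature `ValiantClasses`) are used. [folklore]
-/

-- single-conjunct layout: Sub = Summit, duplicated namespace component intended
set_option linter.dupNamespace false

namespace Summit.ValiantsHypothesis.ValiantsHypothesis.Theorems.DetQPDetqpThesis.FatRowTelescope

open Literature.Computability.AlgebraicComplexity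
open Real Filter Asymptotics

/-- **One step of the recursion.**  If `r' ≤ m^{1-ε} · (r' − r)` with `m > 0` and `r' ≥ 0`, then
`r · exp(m^{ε-1}) ≤ r'`: multiply by `x = m^{ε-1} ≥ 0` (`x · m^{1-ε} = 1`) to get
`r ≤ (1 − x)·r' ≤ e^{−x}·r'`. [folklore] -/
theorem mul_exp_rpow_le_of_step {m r r' ε : ℝ} (hm : 0 < m) (hr' : 0 ≤ r')
    (h : r' ≤ m ^ (1 - ε) * (r' - r)) : r * Real.exp (m ^ (ε - 1)) ≤ r' := by
  have hx0 : 0 ≤ m ^ (ε - 1) := rpow_nonneg hm.le _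
  have hxy : m ^ (ε - 1) * m ^ (1 - ε) = 1 := by
    rw [← rpow_add hm]
    norm_num
  have h1 : m ^ (ε - 1) * r' ≤ r' - r := by
    have := mul_le_mul_of_nonneg_left h hx0
    rwa [← mul_assoc, hxy, one_mul] at this
  have h2 : r ≤ (1 - m ^ (ε - 1)) * r' := by linarith
  have h3 : r ≤ Real.exp (-(m ^ (ε - 1))) * r' :=
    h2.trans (mul_le_mul_of_nonneg_right (Real.one_sub_le_exp_neg _) hr')
  calc r * Real.exp (m ^ (ε - 1))
      ≤ Real.exp (-(m ^ (ε - 1))) * r' * Real.exp (m ^ (ε - 1)) :=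
        mul_le_mul_of_nonneg_right h3 (Real.exp_pos _).le
    _ = r' := by
        rw [mul_comm, ← mul_assoc, ← Real.exp_add, add_neg_cancel, Real.exp_zero, one_mul]

/-- **Bernoulli increment bound.**  For `m > 0` and `0 ≤ ε ≤ 1`:
`(m+1)^ε − m^ε ≤ ε · m^{ε-1}`, from `(1 + 1/m)^ε ≤ 1 + ε/m`
(Mathlib `rpow_one_add_le_one_add_mul_self`). [folklore] -/
theorem rpow_add_one_sub_rpow_le {m ε : ℝ} (hm : 0 < m) (hε0 : 0 ≤ ε) (hε1 : ε ≤ 1) :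
    (m + 1) ^ ε - m ^ ε ≤ ε * m ^ (ε - 1) := by
  have hm0 : m ≠ 0 := hm.ne'
  have hs : (-1 : ℝ) ≤ 1 / m := by
    have : 0 < 1 / m := by positivity
    linarith
  have hb := rpow_one_add_le_one_add_mul_self hs hε0 hε1
  have hsplit : (m + 1) ^ ε = m ^ ε * (1 + 1 / m) ^ ε := by
    rw [← mul_rpow hm.le (by positivity)]
    congr 1
    field_simp
  rw [hsplit, rpow_sub_one hm0]
  have hmε : 0 ≤ m ^ ε := rpow_nonneg hm.le _
  calc m ^ ε * (1 + 1 / m) ^ ε - m ^ ε ≤ m ^ ε * (1 + ε * (1 / m)) - m ^ ε := by gcongr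
    _ = ε * (m ^ ε / m) := by
        field_simp
        ring

/-- **Telescoped growth bound.**  Under the recursion (with `0 < ε ≤ 1` and `1 ≤ r n₀`),
`exp(((N+1)^ε − (n₀+1)^ε)/ε) ≤ r N` for every `N ≥ n₀`. [folklore] -/
theorem exp_telescope_le (r : ℕ → ℕ) {ε : ℝ} (hε : 0 < ε) (hε1 : ε ≤ 1) (n₀ : ℕ)
    (h1 : 1 ≤ r n₀)
    (h3 : ∀ n ≥ n₀, (r (n + 1) : ℝ) ≤ ((n + 1 : ℕ) : ℝ) ^ (1 - ε) * ((r (n + 1) : ℝ) - (r n : ℝ))) :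
    ∀ N ≥ n₀, Real.exp ((((N : ℝ) + 1) ^ ε - ((n₀ : ℝ) + 1) ^ ε) / ε) ≤ r N := by
  intro N hN
  induction N, hN using Nat.le_induction with
  | base =>
    rw [sub_self, zero_div, Real.exp_zero]
    exact_mod_cast h1
  | succ N hN ih =>
    have hm : (0 : ℝ) < (N : ℝ) + 1 := by positivity
    have hstep := h3 N hN
    push_cast at hstep ⊢
    have hone := mul_exp_rpow_le_of_step hm (Nat.cast_nonneg _) hstep
    have hbern := rpow_add_one_sub_rpow_le hm hε.le hε1
    have hsplit : (((N : ℝ) + 1 + 1) ^ ε - ((n₀ : ℝ) + 1) ^ ε) / ε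
        = (((N : ℝ) + 1) ^ ε - ((n₀ : ℝ) + 1) ^ ε) / ε
          + (((N : ℝ) + 1 + 1) ^ ε - ((N : ℝ) + 1) ^ ε) / ε := by ring
    have hincr : (((N : ℝ) + 1 + 1) ^ ε - ((N : ℝ) + 1) ^ ε) / ε ≤ ((N : ℝ) + 1) ^ (ε - 1) := by
      rw [div_le_iff₀ hε]
      linarith
    calc Real.exp ((((N : ℝ) + 1 + 1) ^ ε - ((n₀ : ℝ) + 1) ^ ε) / ε)
        ≤ Real.exp ((((N : ℝ) + 1) ^ ε - ((n₀ : ℝ) + 1) ^ ε) / ε + ((N : ℝ) + 1) ^ (ε - 1)) := by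
          rw [Real.exp_le_exp, hsplit]
          gcongr
      _ = Real.exp ((((N : ℝ) + 1) ^ ε - ((n₀ : ℝ) + 1) ^ ε) / ε)
            * Real.exp (((N : ℝ) + 1) ^ (ε - 1)) := Real.exp_add _ _
      _ ≤ (r N : ℝ) * Real.exp (((N : ℝ) + 1) ^ (ε - 1)) := by gcongr
      _ ≤ r (N + 1) := hone

/-- `Nat.log 2` against the real logarithm: `(Nat.log 2 N) · log 2 ≤ log N` for `N ≠ 0`
(from `2 ^ Nat.log 2 N ≤ N`). [folklore] -/
theorem natLog_mul_log_two_le {N : ℕ} (hN : N ≠ 0) :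
    (Nat.log 2 N : ℝ) * Real.log 2 ≤ Real.log N := by
  have h : (((2 : ℕ) ^ Nat.log 2 N : ℕ) : ℝ) ≤ N := by exact_mod_cast Nat.pow_log_le_self 2 hN
  push_cast at h
  rw [← Real.log_pow]
  exact Real.log_le_log (by positivity) h

/-- **Main lemma (`0 < ε ≤ 1`).**  The recursion, `1 ≤ r` and `r ≤ n^k · d` from `n₀` on force
`¬ IsQPBounded d`. [folklore] -/
theorem not_isQPBounded_of_recursion_of_le_one (k : ℕ) (r d : ℕ → ℕ) {ε : ℝ} (hε : 0 < ε)
    (hε1 : ε ≤ 1) (n₀ : ℕ) (h1 : ∀ n ≥ n₀, 1 ≤ r n) (h2 : ∀ n ≥ n₀, r n ≤ n ^ k * d n)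
    (h3 : ∀ n ≥ n₀, (r (n + 1) : ℝ) ≤ ((n + 1 : ℕ) : ℝ) ^ (1 - ε) * ((r (n + 1) : ℝ) - (r n : ℝ))) :
    ¬ IsQPBounded d := by
  rintro ⟨c, hc⟩
  obtain ⟨A, hA⟩ : ∃ A : ℝ, A = (2 / Real.log 2) ^ c * Real.log 2 := ⟨_, rfl⟩
  -- the comparison function `ε (k log x + A log^c x)` is `o(x^ε)`
  have hlo : (fun x : ℝ => ε * ((k : ℝ) * Real.log x + A * Real.log x ^ c)) =o[atTop]
      fun x : ℝ => x ^ ε := by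
    have hlog : (fun x : ℝ => Real.log x) =o[atTop] fun x : ℝ => x ^ ε :=
      isLittleO_log_rpow_atTop hε
    have hlogc : (fun x : ℝ => Real.log x ^ c) =o[atTop] fun x : ℝ => x ^ ε :=
      (isLittleO_log_rpow_rpow_atTop (c : ℝ) hε).congr_left fun x => Real.rpow_natCast _ _
    exact ((hlog.const_mul_left (k : ℝ)).add (hlogc.const_mul_left A)).const_mul_left ε
  have hev : ∀ᶠ x : ℝ in atTop,
      ‖ε * ((k : ℝ) * Real.log x + A * Real.log x ^ c)‖ ≤ 1 / 2 * ‖x ^ ε‖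
        ∧ 2 * ((n₀ : ℝ) + 1) ^ ε + 1 ≤ x ^ ε :=
    (hlo.def one_half_pos).and ((tendsto_rpow_atTop hε).eventually_ge_atTop _)
  have hevN : ∀ᶠ N : ℕ in atTop,
      ‖ε * ((k : ℝ) * Real.log (N : ℝ) + A * Real.log (N : ℝ) ^ c)‖ ≤ 1 / 2 * ‖(N : ℝ) ^ ε‖
        ∧ 2 * ((n₀ : ℝ) + 1) ^ ε + 1 ≤ (N : ℝ) ^ ε :=
    tendsto_natCast_atTop_atTop.eventually hev
  obtain ⟨N, ⟨hb, hC⟩, hNn₀, hN2c⟩ :=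
    (hevN.and ((eventually_ge_atTop n₀).and (eventually_ge_atTop (2 ^ c)))).exists
  -- elementary facts about `N`
  have hNpos' : 0 < N := lt_of_lt_of_le (Nat.two_pow_pos c) hN2c
  have hN0 : N ≠ 0 := hNpos'.ne'
  have hNpos : (0 : ℝ) < N := by exact_mod_cast hNpos'
  have hcL : c ≤ Nat.log 2 N := Nat.le_log_of_pow_le one_lt_two hN2c
  have hLc : (Nat.log 2 N + c) ^ c ≤ 2 ^ c * Nat.log 2 N ^ c := by
    rw [← mul_pow]
    exact Nat.pow_le_pow_left (by omega) c
  have hlog2 : 0 < Real.log 2 := Real.log_pos one_lt_two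
  have hLreal : (Nat.log 2 N : ℝ) ≤ Real.log N / Real.log 2 := by
    rw [le_div_iff₀ hlog2]
    exact natLog_mul_log_two_le hN0
  -- the chain `exp(((N+1)^ε − C₀)/ε) ≤ r N ≤ N^k · 2^{(L+c)^c}`
  have hgrow := exp_telescope_le r hε hε1 n₀ (h1 n₀ le_rfl) h3 N hNn₀
  have hup : (r N : ℝ) ≤ (N : ℝ) ^ k * (2 : ℝ) ^ ((Nat.log 2 N + c) ^ c) := by
    have := (h2 N hNn₀).trans (Nat.mul_le_mul_left _ (hc N))
    exact_mod_cast this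
  have hR : (0 : ℝ) < (N : ℝ) ^ k * (2 : ℝ) ^ ((Nat.log 2 N + c) ^ c) := by positivity
  have hchain : ((N : ℝ) + 1) ^ ε - ((n₀ : ℝ) + 1) ^ ε
      ≤ ε * ((k : ℝ) * Real.log N + A * Real.log N ^ c) := by
    have h := (Real.le_log_iff_exp_le hR).2 (hgrow.trans hup)
    rw [Real.log_mul (by positivity) (by positivity), Real.log_pow, Real.log_pow,
      div_le_iff₀ hε] at h
    have hLc' : (((Nat.log 2 N + c) ^ c : ℕ) : ℝ) * Real.log 2 ≤ A * Real.log N ^ c := by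
      have h1' : (((Nat.log 2 N + c) ^ c : ℕ) : ℝ) ≤ 2 ^ c * (Nat.log 2 N : ℝ) ^ c := by
        exact_mod_cast hLc
      have h2' : (Nat.log 2 N : ℝ) ^ c ≤ (Real.log N / Real.log 2) ^ c :=
        pow_le_pow_left₀ (Nat.cast_nonneg _) hLreal c
      calc (((Nat.log 2 N + c) ^ c : ℕ) : ℝ) * Real.log 2
          ≤ 2 ^ c * (Real.log N / Real.log 2) ^ c * Real.log 2 := by
            gcongr
            exact h1'.trans (by gcongr)
        _ = A * Real.log N ^ c := by
            rw [hA, div_pow, div_pow]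
            ring
    have := mul_le_mul_of_nonneg_left hLc' hε.le
    nlinarith
  -- contradiction with the eventual smallness of the comparison function
  have hmono : (N : ℝ) ^ ε ≤ ((N : ℝ) + 1) ^ ε := rpow_le_rpow hNpos.le (by linarith) hε.le
  have hb' : ε * ((k : ℝ) * Real.log N + A * Real.log N ^ c) ≤ 1 / 2 * (N : ℝ) ^ ε := by
    rw [Real.norm_of_nonneg (rpow_nonneg hNpos.le ε)] at hb
    exact (Real.le_norm_self _).trans hb
  linarith

/-- **S4 — telescoping: a fat-increment recursion forces super-quasi-polynomial growth.**
If `r ≥ 1`, `r ≤ n^k · d` and `r(n+1) ≤ (n+1)^{1-ε} · (r(n+1) − r(n))` for all `n ≥ n₀`, with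
`ε > 0`, then `d` is not quasi-polynomially bounded.  (For `ε > 1` the recursion implies the one
for `min ε 1`, since it forces `r(n+1) − r(n) ≥ 0`.)  Registered signature of stub `stub_telescope`
of line `fat-row-recursion` for crux `DetQP.DetqpThesis` (stmt-ValiantsHypothesis-0315). [folklore] -/
theorem stub_telescope :
    ∀ (k : ℕ) (r d : ℕ → ℕ) (ε : ℝ), 0 < ε → ∀ n₀ : ℕ,
      (∀ n ≥ n₀, 1 ≤ r n) →
      (∀ n ≥ n₀, r n ≤ n ^ k * d n) →
      (∀ n ≥ n₀, (r (n + 1) : ℝ) ≤ ((n + 1 : ℕ) : ℝ) ^ (1 - ε) * ((r (n + 1) : ℝ) - (r n : ℝ))) →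
      ¬ IsQPBounded d := by
  intro k r d ε hε n₀ h1 h2 h3
  refine not_isQPBounded_of_recursion_of_le_one k r d (lt_min hε one_pos) (min_le_right ε 1)
    n₀ h1 h2 fun n hn => ?_
  have h := h3 n hn
  have hm : (1 : ℝ) ≤ ((n + 1 : ℕ) : ℝ) := by exact_mod_cast Nat.succ_pos n
  have hr1 : (1 : ℝ) ≤ r (n + 1) := by exact_mod_cast h1 (n + 1) (by omega)
  have hpos : 0 ≤ (r (n + 1) : ℝ) - r n := by
    by_contra hneg
    push Not at hneg
    have : ((n + 1 : ℕ) : ℝ) ^ (1 - ε) * ((r (n + 1) : ℝ) - r n) ≤ 0 :=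
      mul_nonpos_of_nonneg_of_nonpos (rpow_nonneg (by positivity) _) hneg.le
    linarith
  calc (r (n + 1) : ℝ) ≤ ((n + 1 : ℕ) : ℝ) ^ (1 - ε) * ((r (n + 1) : ℝ) - r n) := h
    _ ≤ ((n + 1 : ℕ) : ℝ) ^ (1 - min ε 1) * ((r (n + 1) : ℝ) - r n) :=
      mul_le_mul_of_nonneg_right
        (Real.rpow_le_rpow_of_exponent_le hm (sub_le_sub_left (min_le_left ε 1) 1)) hpos

end Summit.ValiantsHypothesis.ValiantsHypothesis.Theorems.DetQPDetqpThesis.FatRowTelescope
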